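import Literature.MathematicalPhysics.QuantumFieldTheory.Balaban1983to89.B1Eq357FluctuationPolynomial
import Literature.MathematicalPhysics.QuantumFieldTheory.Balaban1983to89.B1Ineq358TreeLength

/-!
# `Balaban1983to89.B1Eq356DisplayedBounds` — T. Bałaban, *(Higgs)₂,₃ quantum fields in a finite volume. I. A lower bound*, Commun. Math. Phys.
**85** (1982) 603–626 [Balaban1982Higgs1], (3.56)–(3.58) p. 622 / (3.60) p. 623: **(3.58) AS PRINTED (decay in the length of the shortest graph
connecting the argument points) IMPLIES THE DIAMETER-CURRENCY KERNEL BOUND, and (3.56) FOR THE DISPLAYED INTERACTION `V^{(k)}` OF (3.57) IS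
FINITE AND POSITIVE: `e^{−B}⟨χ(A′)⟩⟨χ(φ′)⟩ ≤ (3.56) ≤ e^{B}`** (`B` the explicit bound of `|V^{(k)}|` on the support of the cut-offs) — so that the
logarithm (3.59)/(3.60) take of it is meaningful; theorems only, a sequel of the typer's `B1Eq357FluctuationPolynomial`

statement-level skeleton of published theorems with citation tags; proofs where landed; nothing here is a claim about the Yang–Mills mass gap

PDF held: `paper:balaban1982-cmp85-higgs23-i` (journal page = PDF page + 602); pp. 622–623 [PDF 20–21] re-read in the materialised text
`~/.lit/texts/paper-balaban1982-cmp85-higgs23-i/p0020.txt`, `p0021.txt`.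

CITATION HEADER (lean-in-tree rule).  lit-balaban typed skeleton (HOME `run/shared/lean/pub/lit-balaban/`), unit `lit-balaban-typer` gen 33
(`literature-prover-lit-balaban-typer-g33-0`; TAKING #1 line HOME/STATUS.md 2026-08-24T20:50:40Z, part (b); free-target protocol G.5-34 (d)).  SKELETON rows
**B1.Prop3.2** ((3.57)–(3.58); decl of record `B1LowerBound.Prop32Printed`, untouched), **B1.Eq3.56** (owner r12; carrier member r14's
`B1Eq356FluctuationIntegral`), **B1.Eq3.60** ((3.56) `≥ exp(…)`, owner r12) — CELLS ONLY, no head change.  USED BY NAME, NOTHING RESTATED: p19's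
`B3Ineq213.treeLen` (*"a length of a shortest tree graph connecting the vertices"*), the typer's `B1Ineq358TreeLength.{diam_le_treeLen, diam_le_treeLen_steiner}`,
p14's `B1Ineq358TreeDecaySum.diam`, r14's `B1Eq356FluctuationIntegral.integral356C`, and the typer's `B1Eq357FluctuationPolynomial.{law356, V357, rv357, chi356,
bound357, integral356C_V357_eq, integral_chi356, abs_rv357_le_of_chi356_ne_zero, abs_V357_le_of_chi_ne_zero, integrable_integrand356, measurable_rv357,
measurable_chi356, chi356_nonneg, chi356_le_one, isProbabilityMeasure_law356}`.

THE SOURCE TEXT (verbatim, p. 622 [PDF 20]).  *"|v^{(k)}_{j₁,…,j_n;μ₁,…,μ_m}(B^{(k+1)}, ψ; x₁, …, x_n, y₁, …, y_m)| ≦ O(1)(L^kε)^{κ₀} exp(−δ₀d(x₁, …, x_n, y₁, …, y_m))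
(3.58) for some independent of k positive constants κ₀, δ₀, and O(1), where d(x₁, …, y_m) denotes a length of the shortest graph connecting the points
x₁, …, y_m."*  p. 623 [PDF 21] (render `…-p021-x2.png`, re-read for v1.1): *"Using the lemma we get (3.56) = ⟨χ(A′)χ(φ′)exp(V^{(k)})⟩ = exp[Σ_{n=1}^{n̄} (1/n!)
⟨(V^{(k)})ⁿ⟩^T + O(1)(L^kε)^κ|T₁^{(k)}|], κ > d. (3.59) … Let us denote the expression we get by 𝒫^{(k+1),L}(B^{(k+1)}, ψ), so we have
(3.56) ≧ exp(𝒫^{(k+1),L}(B^{(k+1)}, ψ) + O(1)(L^kε)^κ|T₁^{(k)}|). (3.60)"* (the first of the two displays numbered (3.60) on p. 623).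
v1.1 (typer gen 33, DOCSTRING-ONLY, every declaration byte-identical to v1 = p392526 ✓ ed1b5eb90880): the v1 header paraphrased (3.59) as
«⟨χχ′e^{V^{(k)}}⟩ = exp[…]» and misquoted (3.60) as «exp(E_k + …)» under a *verbatim* label — corrected above (ref-4 g109 D-g109-1).

WHAT IS PROVED (kernel-checked, 0 `sorry`, standard axioms; theorems only).
 * §0 `coef_bound_diam_of_treeLen` / **`coef_bound_diam_of_steiner`** — (3.58) AS PRINTED (decay in the length of the shortest graph connecting the points,
   on the torus distance, the graph allowed further vertices `w`) IMPLIES the diameter-currency bound `h358 : |v(q; z; κ)| ≤ A₀e^{−δ₀·diam z}` that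
   `B1Eq357FluctuationPolynomial` §4/§5/§7 and p14/r14 consume (`diam z ≤` the length of any graph connecting `z`).
 * §1 **`integral356C_V357_bounds`** (`e^{−B}⟨χ(A′)⟩⟨χ(φ′)⟩ ≤ (3.56) ≤ e^{B}` for the displayed `V^{(k)}`, `B = bound357 …`), **`integral356C_V357_pos`**
   ((3.56) `> 0` once `⟨χ(A′)⟩⟨χ(φ′)⟩ > 0`, e.g. `B1Eq324SmallFieldLeaf.integral_chi_prod_pos`), `integral356C_V357_pos_printed` (the same with (3.58) in
   the printed currency).
HONEST SCOPE.  (3.57)/(3.58) are DISPLAYED hypotheses (Prop. 3.2 is paper III's Prop. 1); nothing of the calculation (3.59)–(3.61) is here; rows keep their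
heads; NOT summit progress; NOT Clay.
-/

open scoped BigOperators NNReal
open _root_.MeasureTheory _root_.ProbabilityTheory

namespace Literature.MathematicalPhysics.QuantumFieldTheory.Balaban1983to89.B1Eq356DisplayedBounds

open HiggsLattice (ChargeData)
open HiggsFluctMeasure (fluctMeasure)
open HiggsCondGauss228 (condGauss fieldOfCrd)
open B1Eq343FluctuationChi (chiFluctA chiFluctφ)
open B1Ineq358TreeDecaySum (diam)
open B3Ineq213 (treeLen)
open B1Ineq358TreeLength (diam_le_treeLen diam_le_treeLen_steiner)
open B1Prop32InteractionBound (Leg)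
open B1Eq356FluctuationIntegral (integral356C)
open B1Eq357FluctuationPolynomial

noncomputable section

variable {P : HiggsLattice.Params} {N : ℕ}
  (C : ChargeData N) (Ω : Finset (HiggsLattice.Site P 0)) (B : HiggsLattice.VecField P 0)

/-! ## §0 (3.58) as printed implies the diameter-currency kernel bound -/

/-- (3.58) with the decay in the length `d(z)` of the shortest SPANNING tree of the argument points (p14's `Mono.dPts` currency: `treeLen` of
the pairwise torus distances) implies the diameter-currency bound `|v| ≤ A₀e^{−δ₀·diam z}` (`diam z ≤ d(z)`, `B1Ineq358TreeLength.diam_le_treeLen`;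
`A₀, δ₀ ≥ 0`). [cite: Balaban1982Higgs1, Prop. 3.2 (3.58) p.622] -/
theorem coef_bound_diam_of_treeLen {k qmax : ℕ} {coef : (q : ℕ) → (Fin q → HiggsLattice.Site P k) → (Fin q → Leg N P.d) → ℝ}
    {A₀ δ₀ : ℝ} (hA₀ : 0 ≤ A₀) (hδ₀ : 0 ≤ δ₀)
    (h : ∀ q, q ≤ qmax → ∀ (z : Fin q → HiggsLattice.Site P k) (κ : Fin q → Leg N P.d),
      |coef q z κ| ≤ A₀ * Real.exp (-(δ₀ * treeLen (fun i j => (HiggsLattice.Site.tdist (z i) (z j) : ℝ))))) :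
    ∀ q, q ≤ qmax → ∀ (z : Fin q → HiggsLattice.Site P k) (κ : Fin q → Leg N P.d),
      |coef q z κ| ≤ A₀ * Real.exp (-(δ₀ * (diam z : ℝ))) := by
  intro q hq z κ
  refine (h q hq z κ).trans (mul_le_mul_of_nonneg_left (Real.exp_le_exp.2 ?_) hA₀)
  have hd := diam_le_treeLen z
  nlinarith

/-- **(3.58) AS PRINTED ⇒ THE DIAMETER CURRENCY**: *"|v^{(k)}(…)| ≦ O(1)(L^kε)^{κ₀}exp(−δ₀d(x₁,…,y_m)) … where d(x₁,…,y_m) denotes a length of the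
shortest graph connecting the points"* — the connecting graph being allowed further vertices `w` (a Steiner tree; for SOME finite vertex set the bound
holds, in particular for the shortest graph) — implies `|v| ≤ A₀e^{−δ₀·diam z}`, the hypothesis `h358` of `B1Eq357FluctuationPolynomial` §4/§5/§7 and
of this file (`diam z ≤` the length of any graph connecting `z`, `B1Ineq358TreeLength.diam_le_treeLen_steiner`; `A₀, δ₀ ≥ 0`).
[cite: Balaban1982Higgs1, Prop. 3.2 (3.58) p.622] -/
theorem coef_bound_diam_of_steiner {k qmax : ℕ} {coef : (q : ℕ) → (Fin q → HiggsLattice.Site P k) → (Fin q → Leg N P.d) → ℝ}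
    {A₀ δ₀ : ℝ} (hA₀ : 0 ≤ A₀) (hδ₀ : 0 ≤ δ₀)
    (h : ∀ q, q ≤ qmax → ∀ (z : Fin q → HiggsLattice.Site P k) (κ : Fin q → Leg N P.d), ∃ (n : ℕ) (w : Fin n → HiggsLattice.Site P k),
      |coef q z κ| ≤ A₀ * Real.exp (-(δ₀ * treeLen (fun a b : Fin q ⊕ Fin n =>
        (HiggsLattice.Site.tdist (Sum.elim z w a) (Sum.elim z w b) : ℝ))))) :
    ∀ q, q ≤ qmax → ∀ (z : Fin q → HiggsLattice.Site P k) (κ : Fin q → Leg N P.d),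
      |coef q z κ| ≤ A₀ * Real.exp (-(δ₀ * (diam z : ℝ))) := by
  intro q hq z κ
  obtain ⟨n, w, hw⟩ := h q hq z κ
  refine hw.trans (mul_le_mul_of_nonneg_left (Real.exp_le_exp.2 ?_) hA₀)
  have hd := diam_le_treeLen_steiner z w
  nlinarith

/-! ## §1 (3.56) for the displayed `V^{(k)}`: two-sided bounds and positivity ((3.60) takes its logarithm) -/

section Bounds356

/-- **`e^{−B}·⟨χ(A′)⟩⟨χ(φ′)⟩ ≤ (3.56) ≤ e^{B}` FOR THE DISPLAYED `V^{(k)}`**, `B = bound357` (the integrand `χ(A′)χ(φ′)e^{V^{(k)}}` lies between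
`χ·e^{−B}` and `χ·e^{B} ≤ e^{B}` pointwise, `|V^{(k)}| ≤ B` on the support of the cut-offs; `μ₀², m² > 0`, `a > 0`, `L > 1`, `k ≤ K`, `t ≥ 0`, (3.58) in the
diameter currency) — so (3.56) is finite and, once `⟨χ(A′)⟩⟨χ(φ′)⟩ > 0`, positive: its logarithm in (3.59)/(3.60) is meaningful.
[cite: Balaban1982Higgs1, (3.56) p.622; (3.60) p.623] -/
theorem integral356C_V357_bounds {μ0sq msq a : ℝ} (hμ : 0 < μ0sq) (hmsq : 0 < msq) (ha : 0 < a) (hL : 1 < (P.L : ℝ)) {k : ℕ} (hk : k ≤ P.K)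
    (qmax : ℕ) (coef : (q : ℕ) → (Fin q → HiggsLattice.Site P k) → (Fin q → Leg N P.d) → ℝ)
    {A₀ δ₀ t : ℝ} (hA₀ : 0 ≤ A₀) (hδ₀ : 0 < δ₀) (ht : 0 ≤ t)
    (h358 : ∀ q, q ≤ qmax → ∀ (z : Fin q → HiggsLattice.Site P k) (κ : Fin q → Leg N P.d),
      |coef q z κ| ≤ A₀ * Real.exp (-(δ₀ * (diam z : ℝ)))) :
    Real.exp (-bound357 P N k qmax A₀ δ₀ t)
        * ((∫ A', chiFluctA t A' ∂(fluctMeasure P μ0sq a k))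
          * ∫ x, chiFluctφ t (fieldOfCrd (Finset.univ : Finset (HiggsLattice.Site P k)) x)
              ∂(condGauss C Ω B msq a k (Finset.univ : Finset (HiggsLattice.Site P k))))
      ≤ integral356C C Ω B μ0sq msq a k t (V357 k qmax coef)
    ∧ integral356C C Ω B μ0sq msq a k t (V357 k qmax coef) ≤ Real.exp (bound357 P N k qmax A₀ δ₀ t) := by
  haveI := isProbabilityMeasure_law356 C Ω B hμ hmsq ha hL hk
  have hVB := abs_rv357_le_of_chi356_ne_zero k qmax coef hA₀ hδ₀ ht h358
  have hint : Integrable (fun ω => chi356 (P := P) (N := N) k t ω * Real.exp (rv357 k qmax coef ω)) (law356 C Ω B μ0sq msq a k) :=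
    integrable_integrand356 C Ω B hμ hmsq ha hL hk t (measurable_rv357 (P := P) (N := N) k qmax coef)
      (fun _ _ h => abs_V357_le_of_chi_ne_zero k qmax coef hA₀ hδ₀ ht h358 h)
  have hχint : Integrable (chi356 (P := P) (N := N) k t) (law356 C Ω B μ0sq msq a k) :=
    (integrable_const (1 : ℝ)).mono' (measurable_chi356 (P := P) (N := N) k t).aestronglyMeasurable
      (ae_of_all _ fun ω => by rw [Real.norm_eq_abs, abs_of_nonneg (chi356_nonneg k t ω)]; exact chi356_le_one k t ω)
  -- pointwise: χ e^{−B} ≤ χ e^{V} ≤ e^{B}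
  have hlow : ∀ ω, chi356 (P := P) (N := N) k t ω * Real.exp (-bound357 P N k qmax A₀ δ₀ t)
      ≤ chi356 (P := P) (N := N) k t ω * Real.exp (rv357 k qmax coef ω) := by
    intro ω
    by_cases h0 : chi356 (P := P) (N := N) k t ω = 0
    · rw [h0, zero_mul, zero_mul]
    · refine mul_le_mul_of_nonneg_left (Real.exp_le_exp.2 ?_) (chi356_nonneg k t ω)
      have := hVB ω h0
      exact (neg_le.1 ((neg_le_abs _).trans this))
  have hup : ∀ ω, chi356 (P := P) (N := N) k t ω * Real.exp (rv357 k qmax coef ω) ≤ Real.exp (bound357 P N k qmax A₀ δ₀ t) := by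
    intro ω
    by_cases h0 : chi356 (P := P) (N := N) k t ω = 0
    · rw [h0, zero_mul]; exact (Real.exp_pos _).le
    · calc chi356 (P := P) (N := N) k t ω * Real.exp (rv357 k qmax coef ω)
          ≤ 1 * Real.exp (bound357 P N k qmax A₀ δ₀ t) :=
            mul_le_mul (chi356_le_one k t ω) (Real.exp_le_exp.2 ((le_abs_self _).trans (hVB ω h0)))
              (Real.exp_pos _).le zero_le_one
        _ = Real.exp (bound357 P N k qmax A₀ δ₀ t) := one_mul _
  rw [integral356C_V357_eq C Ω B hμ hmsq ha hL hk qmax coef hA₀ hδ₀ ht h358, ← integral_chi356 C Ω B hμ hmsq ha hL hk t]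
  constructor
  · calc Real.exp (-bound357 P N k qmax A₀ δ₀ t) * ∫ ω, chi356 (P := P) (N := N) k t ω ∂(law356 C Ω B μ0sq msq a k)
        = ∫ ω, chi356 (P := P) (N := N) k t ω * Real.exp (-bound357 P N k qmax A₀ δ₀ t) ∂(law356 C Ω B μ0sq msq a k) := by
          rw [← integral_const_mul]; exact integral_congr_ae (ae_of_all _ fun ω => by ring)
      _ ≤ ∫ ω, chi356 (P := P) (N := N) k t ω * Real.exp (rv357 k qmax coef ω) ∂(law356 C Ω B μ0sq msq a k) :=
          integral_mono (hχint.mul_const _) hint hlow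
  · calc ∫ ω, chi356 (P := P) (N := N) k t ω * Real.exp (rv357 k qmax coef ω) ∂(law356 C Ω B μ0sq msq a k)
        ≤ ∫ _ω, Real.exp (bound357 P N k qmax A₀ δ₀ t) ∂(law356 C Ω B μ0sq msq a k) := integral_mono hint (integrable_const _) hup
      _ = Real.exp (bound357 P N k qmax A₀ δ₀ t) := by rw [integral_const, probReal_univ, one_smul]

/-- **(3.56) FOR THE DISPLAYED `V^{(k)}` IS POSITIVE** as soon as `⟨χ(A′)⟩⟨χ(φ′)⟩ > 0` (e.g. `B1Eq324SmallFieldLeaf.integral_chi_prod_pos`: both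
Gaussian tails `≤ ½`) — the quantity whose logarithm (3.59)/(3.60) expand. [cite: Balaban1982Higgs1, (3.56) p.622; (3.59) p.623] -/
theorem integral356C_V357_pos {μ0sq msq a : ℝ} (hμ : 0 < μ0sq) (hmsq : 0 < msq) (ha : 0 < a) (hL : 1 < (P.L : ℝ)) {k : ℕ} (hk : k ≤ P.K)
    (qmax : ℕ) (coef : (q : ℕ) → (Fin q → HiggsLattice.Site P k) → (Fin q → Leg N P.d) → ℝ)
    {A₀ δ₀ t : ℝ} (hA₀ : 0 ≤ A₀) (hδ₀ : 0 < δ₀) (ht : 0 ≤ t)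
    (h358 : ∀ q, q ≤ qmax → ∀ (z : Fin q → HiggsLattice.Site P k) (κ : Fin q → Leg N P.d),
      |coef q z κ| ≤ A₀ * Real.exp (-(δ₀ * (diam z : ℝ))))
    (hpos : 0 < (∫ A', chiFluctA t A' ∂(fluctMeasure P μ0sq a k))
        * ∫ x, chiFluctφ t (fieldOfCrd (Finset.univ : Finset (HiggsLattice.Site P k)) x)
            ∂(condGauss C Ω B msq a k (Finset.univ : Finset (HiggsLattice.Site P k)))) :
    0 < integral356C C Ω B μ0sq msq a k t (V357 k qmax coef) :=
  lt_of_lt_of_le (mul_pos (Real.exp_pos _) hpos) (integral356C_V357_bounds C Ω B hμ hmsq ha hL hk qmax coef hA₀ hδ₀ ht h358).1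

/-- **(3.56) `> 0` FOR THE DISPLAYED `V^{(k)}` WITH (3.58) IN THE PRINTED CURRENCY** (Steiner tree length; `coef_bound_diam_of_steiner`).
[cite: Balaban1982Higgs1, (3.56) p.622; Prop. 3.2 (3.58) p.622] -/
theorem integral356C_V357_pos_printed {μ0sq msq a : ℝ} (hμ : 0 < μ0sq) (hmsq : 0 < msq) (ha : 0 < a) (hL : 1 < (P.L : ℝ)) {k : ℕ}
    (hk : k ≤ P.K) (qmax : ℕ) (coef : (q : ℕ) → (Fin q → HiggsLattice.Site P k) → (Fin q → Leg N P.d) → ℝ)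
    {A₀ δ₀ t : ℝ} (hA₀ : 0 ≤ A₀) (hδ₀ : 0 < δ₀) (ht : 0 ≤ t)
    (h358 : ∀ q, q ≤ qmax → ∀ (z : Fin q → HiggsLattice.Site P k) (κ : Fin q → Leg N P.d), ∃ (n : ℕ) (w : Fin n → HiggsLattice.Site P k),
      |coef q z κ| ≤ A₀ * Real.exp (-(δ₀ * treeLen (fun a b : Fin q ⊕ Fin n =>
        (HiggsLattice.Site.tdist (Sum.elim z w a) (Sum.elim z w b) : ℝ)))))
    (hpos : 0 < (∫ A', chiFluctA t A' ∂(fluctMeasure P μ0sq a k))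
        * ∫ x, chiFluctφ t (fieldOfCrd (Finset.univ : Finset (HiggsLattice.Site P k)) x)
            ∂(condGauss C Ω B msq a k (Finset.univ : Finset (HiggsLattice.Site P k)))) :
    0 < integral356C C Ω B μ0sq msq a k t (V357 k qmax coef) :=
  integral356C_V357_pos C Ω B hμ hmsq ha hL hk qmax coef hA₀ hδ₀ ht (coef_bound_diam_of_steiner hA₀ hδ₀.le h358) hpos

end Bounds356


end

end Literature.MathematicalPhysics.QuantumFieldTheory.Balaban1983to89.B1Eq356DisplayedBounds
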